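import Summits.KontsevichZagierPeriods.KontsevichZagierPeriods.Theorems.LogKernelConjecture.Negative.Sandwich
import Summits.KontsevichZagierPeriods.KontsevichZagierPeriods.Theorems.ReducedPeriodRing.Negative.Certificates

/-!
# `LogKernelConjecture` (stmt-KontsevichZagierPeriods-2837) — negative knowledge, part 3: no torsion kill

The relation group of the FIVE-rule calculus, `logClosure = closure (KZ.relations ∪ logNLInstances)`
(part 1, `Negative/Sandwich.lean`), is division-closed: `N • c ∈ logClosure → c ∈ logClosure`
for `N ≥ 1` (`mem_logClosure_of_nsmul_mem`), unconditionally.  Ingredients: scaling a logarithmic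
instance by `1/N` is again a logarithmic instance (`exists_logNLInstance_sub_nsmul`), so
`logClosure` is divisible modulo `KZ.relations` (`exists_sub_nsmul_of_mem_logClosure`); and
`KZ.relations` itself is division-closed (`mem_relations_of_nsmul_mem_relations`, from the unique
divisibility of the formal period ring, `ReducedPeriodRingNegative.nsmul_bijective`).  Consequences
for refuters of the crux: a torsion element of `FormalRep ⧸ logClosure` would refute it
(`not_logKernelConjecture_of_torsion`) but none exists (`no_torsion_witness`); and no additive
invariant of the four moves with values of bounded exponent can be the exotic invariant of
`not_logKernelConjecture_iff_invariant` (`no_bounded_exponent_kill`).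
[cite: KontsevichZagierPeriods2001, §1.2 rule (1)]
-/

noncomputable section

open MeasureTheory Set
open Literature.NumberTheory.Transcendental

namespace Summit.KontsevichZagierPeriods.LiouvilleUnfolding.LogKernelConjectureNegative

open Summit.KontsevichZagierPeriods.KontsevichZagierPeriods.Theses.LiouvilleUnfolding
  (LogKernelConjecture LogPrimitiveNL)

open Summit.KontsevichZagierPeriods.KontsevichZagierPeriods.ReducedPeriodRingNegative
  (of_sub_nsmul_of_constMul_inv_mem_relations nsmul_bijective bounded_exponent_certificate_vanishes)

/-- **Integer division in `KZ.relations`** (the FurushoPentagon support item `IntegerDivision`,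
stmt-3934, derived here from the tree's unique divisibility of the formal period ring
`nsmul_bijective`): `N • c ∈ relations → c ∈ relations` for `N ≥ 1`. [folklore] -/
theorem mem_relations_of_nsmul_mem_relations {c : KZ.FormalRep} {N : ℕ} (hN : 0 < N)
    (h : N • c ∈ KZ.relations) : c ∈ KZ.relations := by
  rw [← KZ.toFormalPeriod_eq_zero_iff] at h ⊢
  rw [map_nsmul] at h
  exact (nsmul_bijective hN).1 (by simpa using h)

/-- **Scaling a logarithmic instance by `1/N` gives a logarithmic instance** (`hᵢ ↦ hᵢ/N`, same
band, same `Vᵢ`), and `d − N • d_N` is an ordinary relation (iterated integrand additivity,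
`of_sub_nsmul_of_constMul_inv_mem_relations`). [folklore] -/
theorem exists_logNLInstance_sub_nsmul {d : KZ.FormalRep} (hd : d ∈ logNLInstances) {N : ℕ}
    (hN : 0 < N) : ∃ d' ∈ logNLInstances, d - N • d' ∈ KZ.relations := by
  obtain ⟨n, k, r, r', a, b, h, V, V', ha, hb, hab, hdom, hh, hV, hpos, hcont, hder, hint, hr, hr',
    rfl⟩ := hd
  have hqa : IsAlgebraic ℚ ((N : ℝ)⁻¹) := (isAlgebraic_nat N).inv
  refine ⟨KZ.of (r.constMul ((N : ℝ)⁻¹) hqa) - KZ.of (r'.constMul ((N : ℝ)⁻¹) hqa), ?_, ?_⟩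
  · refine ⟨n, k, r.constMul ((N : ℝ)⁻¹) hqa, r'.constMul ((N : ℝ)⁻¹) hqa, a, b,
      fun i x => (N : ℝ)⁻¹ * h i x, V, V', ha, hb, hab, hdom, ?_, hV, hpos, hcont, hder, ?_, ?_, ?_,
      rfl⟩
    · intro i
      exact IsSemialgebraicFunOn.mul_holds
        (isSemialgebraicFunOn_const_of_isAlgebraic r'.isSemialgebraic_domain hqa) (hh i)
    · intro i
      have heq : (fun z : Fin (n + 1) → ℝ => (N : ℝ)⁻¹ * h i (Fin.init z) * V' i z / V i z) =
          fun z => (N : ℝ)⁻¹ * (h i (Fin.init z) * V' i z / V i z) := by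
        funext z; ring
      rw [KZ.IntegralRep.domain_constMul, heq]
      exact (hint i).const_mul _
    · intro x hx t ht
      rw [KZ.IntegralRep.domain_constMul] at hx
      simp only [KZ.IntegralRep.integrand_constMul]
      rw [hr x hx t ht, Finset.mul_sum]
      exact Finset.sum_congr rfl fun i _ => by ring
    · intro x hx
      rw [KZ.IntegralRep.domain_constMul] at hx
      simp only [KZ.IntegralRep.integrand_constMul]
      rw [hr' x hx, Finset.mul_sum]
      exact Finset.sum_congr rfl fun i _ => by ring
  · have h1 := of_sub_nsmul_of_constMul_inv_mem_relations r hN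
    have h2 := of_sub_nsmul_of_constMul_inv_mem_relations r' hN
    have heq : (KZ.of r - KZ.of r') -
        N • (KZ.of (r.constMul ((N : ℝ)⁻¹) hqa) - KZ.of (r'.constMul ((N : ℝ)⁻¹) hqa)) =
        (KZ.of r - N • KZ.of (r.constMul ((N : ℝ)⁻¹) hqa)) -
          (KZ.of r' - N • KZ.of (r'.constMul ((N : ℝ)⁻¹) hqa)) := by
      rw [smul_sub]; abel
    rw [heq]
    exact KZ.relations.sub_mem h1 h2

/-- `logClosure` is divisible modulo `relations`: every element is `N` times another one, up to an
ordinary relation. [folklore] -/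
theorem exists_sub_nsmul_of_mem_logClosure {x : KZ.FormalRep} (hx : x ∈ logClosure) {N : ℕ}
    (hN : 0 < N) : ∃ y ∈ logClosure, x - N • y ∈ KZ.relations := by
  induction hx using AddSubgroup.closure_induction with
  | mem x hx =>
    rcases hx with hx | hx
    · exact ⟨0, logClosure.zero_mem, by simpa using hx⟩
    · obtain ⟨d', hd', h⟩ := exists_logNLInstance_sub_nsmul hx hN
      exact ⟨d', logNLInstances_subset_logClosure hd', h⟩
  | zero => exact ⟨0, logClosure.zero_mem, by simp [KZ.relations.zero_mem]⟩
  | add x y _ _ hx hy =>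
    obtain ⟨x', hx', h₁⟩ := hx
    obtain ⟨y', hy', h₂⟩ := hy
    refine ⟨x' + y', logClosure.add_mem hx' hy', ?_⟩
    have heq : x + y - N • (x' + y') = (x - N • x') + (y - N • y') := by rw [smul_add]; abel
    rw [heq]
    exact KZ.relations.add_mem h₁ h₂
  | neg x _ hx =>
    obtain ⟨x', hx', h₁⟩ := hx
    refine ⟨-x', logClosure.neg_mem hx', ?_⟩
    have heq : -x - N • (-x') = -(x - N • x') := by rw [smul_neg]; abel
    rw [heq]
    exact KZ.relations.neg_mem h₁

/-- **`FormalRep ⧸ logClosure` is torsion-free**: `N • c ∈ logClosure → c ∈ logClosure`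
(`N ≥ 1`), unconditionally. [folklore] -/
theorem mem_logClosure_of_nsmul_mem {c : KZ.FormalRep} {N : ℕ} (hN : 0 < N)
    (h : N • c ∈ logClosure) : c ∈ logClosure := by
  obtain ⟨y, hy, hrel⟩ := exists_sub_nsmul_of_mem_logClosure h hN
  have hN' : N • (c - y) ∈ KZ.relations := by rwa [smul_sub]
  have hcy := mem_relations_of_nsmul_mem_relations hN hN'
  have := logClosure.add_mem (relations_le_logClosure hcy) hy
  simpa using this

/-- A torsion witness WOULD have killed the crux (`eval (N • c) = 0 ⇒ eval c = 0`) … [folklore] -/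
theorem not_logKernelConjecture_of_torsion
    (h : ∃ (c : KZ.FormalRep) (N : ℕ), 0 < N ∧ N • c ∈ logClosure ∧ c ∉ logClosure) :
    ¬ LogKernelConjecture := by
  obtain ⟨c, N, hN, hNc, hc⟩ := h
  rw [logKernelConjecture_iff_ker_le]
  intro hk
  have h0 : KZ.eval (N • c) = 0 := (AddMonoidHom.mem_ker).1 (logClosure_le_ker hNc)
  rw [map_nsmul, nsmul_eq_mul, mul_eq_zero] at h0
  rcases h0 with h0 | h0
  · exact (Nat.cast_ne_zero.2 hN.ne') h0
  · exact hc (hk ((AddMonoidHom.mem_ker).2 h0))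

/-- … but **there is no torsion witness** (`mem_logClosure_of_nsmul_mem`): this refutation
avenue is closed unconditionally. [folklore] -/
theorem no_torsion_witness :
    ¬ ∃ (c : KZ.FormalRep) (N : ℕ), 0 < N ∧ N • c ∈ logClosure ∧ c ∉ logClosure := by
  rintro ⟨c, N, hN, hNc, hc⟩
  exact hc (mem_logClosure_of_nsmul_mem hN hNc)

/-- **No finite-valued (bounded-exponent) kill**: an additive invariant killing the four moves with
values in a group of bounded exponent (`ℤ/N`, `𝔽_p`-vector spaces, finite groups: parity and
counting invariants of the (domain, integrand) data) vanishes identically — `FormalRep ⧸ relations`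
is divisible (tree: `bounded_exponent_certificate_vanishes`). So the `φ` of
`not_logKernelConjecture_iff_invariant` must have unbounded exponent on its image. [folklore] -/
theorem no_bounded_exponent_kill :
    ¬ ∃ (A : Type) (_ : AddCommGroup A) (φ : KZ.FormalRep →+ A) (N : ℕ), 0 < N ∧
        (∀ a : A, N • a = 0) ∧ KZ.relations ≤ φ.ker ∧ ∃ c : KZ.FormalRep, φ c ≠ 0 := by
  rintro ⟨A, _, φ, N, hN, hA, hrel, c, hc⟩
  exact hc (bounded_exponent_certificate_vanishes φ (fun c hc => (AddMonoidHom.mem_ker).1 (hrel hc))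
    hN hA c)

end Summit.KontsevichZagierPeriods.LiouvilleUnfolding.LogKernelConjectureNegative
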